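import Literature.AnabelianGeometry.SemiGraphs.BTempQDPairQuotients
import Literature.AnabelianGeometry.SemiGraphs.TemperedVerticialInjective
import HarnessLib

/-!
# Semi-graphs of anabelioids, Appendix, proof of Theorem A.4: fibre products and orbit
# sub-objects of `B^temp(Π)`, and the automorphisms they inherit

Mochizuki, *Semi-graphs of anabelioids*, Publ. RIMS **42** (2006) 221–322, Appendix, proof of
Theorem A.4, manuscript pp. 83–84 (PRIMS p. 313 l. 14 – p. 314 l. 4)
[cite: MochizukiSemiAnbd2006, Thm A.4 proof pp.83-84]: the argument manipulates, inside the
temperoid `T_i`, fibre products "`C ×_{C/Γ_C} C`", "`B ×_{C/Γ_C} C`" (implicitly, to produce the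
1-proper covers `(B′, Γ_B′) → (B, Γ_B)`), their CONNECTED COMPONENTS ("each connected component `B′`
of `B` determines a strongly connected QD-pair `(B′, Γ_B′)` [i.e., where we take `Γ_B′ ⊆ Γ_B` to be
the subgroup of automorphisms that fix the element `[B′] ∈ π₀(B)`]", p. 84), and the automorphism
groups these inherit.  This file records that bookkeeping for the model temperoid `B^temp(Π)`
(explicit objects with their points, so that the rows A4-S / A4-lim of
`plan/L3/SUBDAG-SemiAnbd-Cor311.md` can be proved on points):

* `BTemp.pullbackObj f g` — the fibre product `{(x, y) | f x = g y}` of `f : X → Z ← Y : g` with the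
  diagonal action (countable; stabiliser of `(x, y)` = `Stab(x) ∩ Stab(y)`, open), its projections
  `pullbackFst`/`pullbackSnd` and the square `pullback_condition`; `pullbackAut` — a pair of
  automorphisms `σ` of `X` over `Z` and `τ` of `Y` over `Z` acts on the fibre product;
* `BTemp.orbitObj X x₀` — the `Π`-orbit of a point as an object (a CONNECTED sub-object,
  `orbitObj_isConnectedObj`), its inclusion `orbitIncl` (injective), its base point `orbitPt`;
* `BTemp.stabOrbit X x₀ ≤ Aut(X)` — the automorphisms stabilising the orbit of `x₀` (equivalently
  moving `x₀` inside its orbit), and `BTemp.restrictOrbit : stabOrbit X x₀ →* Aut (orbitObj X x₀)` —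
  "the subgroup of automorphisms that fix the element `[B′] ∈ π₀(B)`" acting on `B′`.

`Π` is any group with a topology (no continuity or temperedness needed here).  Elementary; nothing
refers to the IUT corpus; no side is taken on any disputed claim.
-/

open CategoryTheory

namespace Literature.AnabelianGeometry.SemiGraphs

open Literature.AlgebraicGeometry.Frobenioids (IsConnectedObj)
open Literature.AlgebraicGeometry.Frobenioids.QuasiTemperoid.BTempConnected (hom_ρ hom_ext_apply
  ρ_one_apply ρ_mul_apply ρ_inv_apply ρ_apply_inv isConnectedObj_of_transitive)

universe u

namespace BTemp

variable {G : Type u} [Group G] [TopologicalSpace G]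

/-! ### Fibre products -/

section Pullback

variable {X Y Z : BTemp G} (f : X ⟶ Z) (g : Y ⟶ Z)

/-- **The fibre product `X ×_Z Y`** in `B^temp(Π)`: pairs `(x, y)` with `f x = g y`, diagonal action.
[cite: MochizukiSemiAnbd2006, Thm A.4 proof pp.83-84] -/
def pullbackObj : BTemp G :=
  ⟨{ V := {p : X.obj.V × Y.obj.V // (f.hom.hom p.1 : Z.obj.V) = g.hom.hom p.2}
     ρ := { toFun := fun a => TypeCat.ofHom fun p =>
              ⟨(X.obj.ρ a p.1.1, Y.obj.ρ a p.1.2), by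
                change (f.hom.hom (X.obj.ρ a p.1.1) : Z.obj.V) = g.hom.hom (Y.obj.ρ a p.1.2)
                rw [hom_ρ, hom_ρ, p.2]⟩
            map_one' := by
              refine ConcreteCategory.hom_ext _ _ fun p => Subtype.ext ?_
              change (X.obj.ρ 1 p.1.1, Y.obj.ρ 1 p.1.2) = p.1
              rw [ρ_one_apply, ρ_one_apply]
            map_mul' := fun a b => by
              refine ConcreteCategory.hom_ext _ _ fun p => Subtype.ext ?_
              change (X.obj.ρ (a * b) p.1.1, Y.obj.ρ (a * b) p.1.2) =
                (X.obj.ρ a (X.obj.ρ b p.1.1), Y.obj.ρ a (Y.obj.ρ b p.1.2))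
              rw [ρ_mul_apply, ρ_mul_apply] } }, by
    haveI : Countable X.obj.V := X.property.1
    haveI : Countable Y.obj.V := Y.property.1
    refine ⟨Subtype.countable, fun p => ?_⟩
    have : {a : G | (TypeCat.ofHom fun q : {p : X.obj.V × Y.obj.V //
          (f.hom.hom p.1 : Z.obj.V) = g.hom.hom p.2} =>
          (⟨(X.obj.ρ a q.1.1, Y.obj.ρ a q.1.2), by
            change (f.hom.hom (X.obj.ρ a q.1.1) : Z.obj.V) = g.hom.hom (Y.obj.ρ a q.1.2)
            rw [hom_ρ, hom_ρ, q.2]⟩ : {p : X.obj.V × Y.obj.V //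
              (f.hom.hom p.1 : Z.obj.V) = g.hom.hom p.2})) p = p}
        = {a : G | X.obj.ρ a p.1.1 = p.1.1} ∩ {a : G | Y.obj.ρ a p.1.2 = p.1.2} := by
      ext a
      simp only [Set.mem_setOf_eq, Set.mem_inter_iff, TypeCat.ofHom_apply, Subtype.ext_iff,
        Prod.ext_iff]
    exact this ▸ (X.property.2 p.1.1).inter (Y.property.2 p.1.2)⟩

/-- A point of the fibre product from a compatible pair. [cite: MochizukiSemiAnbd2006, Thm A.4 proof pp.83-84] -/
def pullbackPt (x : X.obj.V) (y : Y.obj.V) (h : (f.hom.hom x : Z.obj.V) = g.hom.hom y) :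
    (pullbackObj f g).obj.V := ⟨(x, y), h⟩

/-- The action on the fibre product is diagonal. [cite: MochizukiSemiAnbd2006, Thm A.4 proof pp.83-84] -/
theorem pullbackObj_ρ_val (a : G) (p : (pullbackObj f g).obj.V) :
    ((pullbackObj f g).obj.ρ a p).1 = (X.obj.ρ a p.1.1, Y.obj.ρ a p.1.2) := rfl

/-- First projection `X ×_Z Y → X`. [cite: MochizukiSemiAnbd2006, Thm A.4 proof pp.83-84] -/
def pullbackFst : pullbackObj f g ⟶ X :=
  ObjectProperty.homMk { hom := TypeCat.ofHom fun p => p.1.1, comm := fun _ => rfl }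

/-- Second projection `X ×_Z Y → Y`. [cite: MochizukiSemiAnbd2006, Thm A.4 proof pp.83-84] -/
def pullbackSnd : pullbackObj f g ⟶ Y :=
  ObjectProperty.homMk { hom := TypeCat.ofHom fun p => p.1.2, comm := fun _ => rfl }

/-- The projections on points. [cite: MochizukiSemiAnbd2006, Thm A.4 proof pp.83-84] -/
@[simp] theorem pullbackFst_apply (p : (pullbackObj f g).obj.V) :
    ((pullbackFst f g).hom.hom p : X.obj.V) = p.1.1 := rfl

/-- The projections on points. [cite: MochizukiSemiAnbd2006, Thm A.4 proof pp.83-84] -/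
@[simp] theorem pullbackSnd_apply (p : (pullbackObj f g).obj.V) :
    ((pullbackSnd f g).hom.hom p : Y.obj.V) = p.1.2 := rfl

/-- The square commutes. [cite: MochizukiSemiAnbd2006, Thm A.4 proof pp.83-84] -/
theorem pullback_condition : pullbackFst f g ≫ f = pullbackSnd f g ≫ g :=
  hom_ext_apply fun p => p.2

/-- Points of the fibre product are determined by their two projections.
[cite: MochizukiSemiAnbd2006, Thm A.4 proof pp.83-84] -/
theorem pullbackObj_ext {p q : (pullbackObj f g).obj.V} (h₁ : p.1.1 = q.1.1) (h₂ : p.1.2 = q.1.2) :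
    p = q :=
  Subtype.ext (Prod.ext h₁ h₂)

/-- **Automorphisms of the fibre product from compatible pairs**: an automorphism `σ` of `X` over `Z`
and an automorphism `τ` of `Y` over `Z` induce `σ × τ` on `X ×_Z Y`.
[cite: MochizukiSemiAnbd2006, Thm A.4 proof pp.83-84] -/
def pullbackAut (σ : Aut X) (τ : Aut Y) (hσ : σ.hom ≫ f = f) (hτ : τ.hom ≫ g = g) :
    Aut (pullbackObj f g) :=
  BTemp.isoOfEquiv
    { toFun := fun p => ⟨(σ.hom.hom.hom p.1.1, τ.hom.hom.hom p.1.2), by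
        change ((σ.hom ≫ f).hom.hom p.1.1 : Z.obj.V) = (τ.hom ≫ g).hom.hom p.1.2
        rw [hσ, hτ]; exact p.2⟩
      invFun := fun p => ⟨(σ.inv.hom.hom p.1.1, τ.inv.hom.hom p.1.2), by
        have hσ' : σ.inv ≫ f = f := by rw [Iso.inv_comp_eq, hσ]
        have hτ' : τ.inv ≫ g = g := by rw [Iso.inv_comp_eq, hτ]
        change ((σ.inv ≫ f).hom.hom p.1.1 : Z.obj.V) = (τ.inv ≫ g).hom.hom p.1.2
        rw [hσ', hτ']; exact p.2⟩
      left_inv := fun p => pullbackObj_ext f g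
        (by change ((σ.hom ≫ σ.inv).hom.hom p.1.1 : X.obj.V) = p.1.1; rw [σ.hom_inv_id]; rfl)
        (by change ((τ.hom ≫ τ.inv).hom.hom p.1.2 : Y.obj.V) = p.1.2; rw [τ.hom_inv_id]; rfl)
      right_inv := fun p => pullbackObj_ext f g
        (by change ((σ.inv ≫ σ.hom).hom.hom p.1.1 : X.obj.V) = p.1.1; rw [σ.inv_hom_id]; rfl)
        (by change ((τ.inv ≫ τ.hom).hom.hom p.1.2 : Y.obj.V) = p.1.2; rw [τ.inv_hom_id]; rfl) }
    fun a p => pullbackObj_ext f g (hom_ρ σ.hom a p.1.1) (hom_ρ τ.hom a p.1.2)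

/-- `σ × τ` on points. [cite: MochizukiSemiAnbd2006, Thm A.4 proof pp.83-84] -/
@[simp] theorem pullbackAut_apply_val (σ : Aut X) (τ : Aut Y) (hσ : σ.hom ≫ f = f)
    (hτ : τ.hom ≫ g = g) (p : (pullbackObj f g).obj.V) :
    ((pullbackAut f g σ τ hσ hτ).hom.hom.hom p).1 = (σ.hom.hom.hom p.1.1, τ.hom.hom.hom p.1.2) := rfl

/-- `σ × τ` commutes with the first projection. [cite: MochizukiSemiAnbd2006, Thm A.4 proof pp.83-84] -/
theorem pullbackAut_fst (σ : Aut X) (τ : Aut Y) (hσ : σ.hom ≫ f = f) (hτ : τ.hom ≫ g = g) :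
    (pullbackAut f g σ τ hσ hτ).hom ≫ pullbackFst f g = pullbackFst f g ≫ σ.hom :=
  hom_ext_apply fun _ => rfl

/-- `σ × τ` commutes with the second projection. [cite: MochizukiSemiAnbd2006, Thm A.4 proof pp.83-84] -/
theorem pullbackAut_snd (σ : Aut X) (τ : Aut Y) (hσ : σ.hom ≫ f = f) (hτ : τ.hom ≫ g = g) :
    (pullbackAut f g σ τ hσ hτ).hom ≫ pullbackSnd f g = pullbackSnd f g ≫ τ.hom :=
  hom_ext_apply fun _ => rfl

end Pullback

/-! ### Orbits as sub-objects -/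

section Orbit

variable (X : BTemp G) (x₀ : X.obj.V)

/-- **The `Π`-orbit of `x₀` as an object of `B^temp(Π)`** (points `{y | ∃ a, a · x₀ = y}`, restricted
action) — a connected component of `X` ("each connected component `B′` of `B`", p. 84).
[cite: MochizukiSemiAnbd2006, Thm A.4 proof p.84] -/
def orbitObj : BTemp G :=
  ⟨{ V := {y : X.obj.V // ∃ a : G, X.obj.ρ a x₀ = y}
     ρ := { toFun := fun a => TypeCat.ofHom fun y =>
              ⟨X.obj.ρ a y.1, by
                obtain ⟨b, hb⟩ := y.2
                exact ⟨a * b, by rw [ρ_mul_apply, hb]⟩⟩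
            map_one' := by
              refine ConcreteCategory.hom_ext _ _ fun y => Subtype.ext ?_
              exact ρ_one_apply X y.1
            map_mul' := fun a b => by
              refine ConcreteCategory.hom_ext _ _ fun y => Subtype.ext ?_
              exact ρ_mul_apply X a b y.1 } }, by
    haveI : Countable X.obj.V := X.property.1
    refine ⟨Subtype.countable, fun y => ?_⟩
    have : {a : G | (TypeCat.ofHom fun z : {y : X.obj.V // ∃ a : G, X.obj.ρ a x₀ = y} =>
          (⟨X.obj.ρ a z.1, by
            obtain ⟨b, hb⟩ := z.2
            exact ⟨a * b, by rw [ρ_mul_apply, hb]⟩⟩ : {y : X.obj.V // ∃ a : G, X.obj.ρ a x₀ = y})) y = y}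
        = {a : G | X.obj.ρ a y.1 = y.1} := by
      ext a
      simp only [Set.mem_setOf_eq, TypeCat.ofHom_apply, Subtype.ext_iff]
    exact this ▸ X.property.2 y.1⟩

/-- The action on the orbit object, on underlying points. [cite: MochizukiSemiAnbd2006, Thm A.4 proof p.84] -/
@[simp] theorem orbitObj_ρ_val (a : G) (y : (orbitObj X x₀).obj.V) :
    ((orbitObj X x₀).obj.ρ a y).1 = X.obj.ρ a y.1 := rfl

/-- The base point `x₀` of its orbit. [cite: MochizukiSemiAnbd2006, Thm A.4 proof p.84] -/
def orbitPt : (orbitObj X x₀).obj.V := ⟨x₀, 1, ρ_one_apply X x₀⟩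

/-- The inclusion of the orbit. [cite: MochizukiSemiAnbd2006, Thm A.4 proof p.84] -/
def orbitIncl : orbitObj X x₀ ⟶ X :=
  ObjectProperty.homMk { hom := TypeCat.ofHom fun y => y.1, comm := fun _ => rfl }

/-- The inclusion on points. [cite: MochizukiSemiAnbd2006, Thm A.4 proof p.84] -/
@[simp] theorem orbitIncl_apply (y : (orbitObj X x₀).obj.V) :
    ((orbitIncl X x₀).hom.hom y : X.obj.V) = y.1 := rfl

/-- The inclusion of the orbit is injective. [cite: MochizukiSemiAnbd2006, Thm A.4 proof p.84] -/
theorem orbitIncl_injective :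
    Function.Injective fun y : (orbitObj X x₀).obj.V => ((orbitIncl X x₀).hom.hom y : X.obj.V) :=
  fun _ _ h => Subtype.ext h

/-- The orbit is transitive from its base point. [cite: MochizukiSemiAnbd2006, Thm A.4 proof p.84] -/
theorem orbitObj_transitive (y : (orbitObj X x₀).obj.V) :
    ∃ a : G, (orbitObj X x₀).obj.ρ a (orbitPt X x₀) = y := by
  obtain ⟨a, ha⟩ := y.2
  exact ⟨a, Subtype.ext ha⟩

/-- **The orbit object is connected** (a single `Π`-orbit). [cite: MochizukiSemiAnbd2006, Thm A.4 proof p.84] -/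
theorem orbitObj_isConnectedObj : IsConnectedObj (orbitObj X x₀) :=
  isConnectedObj_of_transitive _ (orbitPt X x₀) (orbitObj_transitive X x₀)

/-- **The automorphisms of `X` stabilising the orbit of `x₀`** ("the subgroup of automorphisms that
fix the element `[B′] ∈ π₀(B)`"): `σ` with `σ x₀ ∈ Π · x₀` — then `σ` maps the whole orbit onto
itself, being `Π`-equivariant. [cite: MochizukiSemiAnbd2006, Thm A.4 proof p.84] -/
def stabOrbit : Subgroup (Aut X) where
  carrier := {σ | ∃ a : G, X.obj.ρ a x₀ = σ.hom.hom.hom x₀}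
  one_mem' := ⟨1, ρ_one_apply X x₀⟩
  mul_mem' := by
    rintro σ τ ⟨a, ha⟩ ⟨b, hb⟩
    refine ⟨b * a, ?_⟩
    change X.obj.ρ (b * a) x₀ = σ.hom.hom.hom (τ.hom.hom.hom x₀)
    rw [ρ_mul_apply, ha, ← hom_ρ σ.hom b x₀, hb]
  inv_mem' := by
    rintro σ ⟨a, ha⟩
    refine ⟨a⁻¹, ?_⟩
    change X.obj.ρ a⁻¹ x₀ = σ.inv.hom.hom x₀
    have h : (σ.inv.hom.hom (σ.hom.hom.hom x₀) : X.obj.V) = x₀ := by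
      change ((σ.hom ≫ σ.inv).hom.hom x₀ : X.obj.V) = x₀
      rw [σ.hom_inv_id]; rfl
    rw [← ha, hom_ρ σ.inv] at h
    -- `h : a · σ⁻¹ x₀ = x₀`
    have h' := congrArg (X.obj.ρ a⁻¹) h
    rw [ρ_inv_apply] at h'
    exact h'.symm

/-- Membership in the orbit stabiliser. [cite: MochizukiSemiAnbd2006, Thm A.4 proof p.84] -/
theorem mem_stabOrbit_iff (σ : Aut X) :
    σ ∈ stabOrbit X x₀ ↔ ∃ a : G, X.obj.ρ a x₀ = σ.hom.hom.hom x₀ := Iff.rfl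

/-- An automorphism stabilising the orbit maps every point of the orbit into the orbit.
[cite: MochizukiSemiAnbd2006, Thm A.4 proof p.84] -/
theorem exists_ρ_eq_aut_apply_of_mem_stabOrbit {σ : Aut X} (hσ : σ ∈ stabOrbit X x₀)
    (y : (orbitObj X x₀).obj.V) : ∃ a : G, X.obj.ρ a x₀ = σ.hom.hom.hom y.1 := by
  obtain ⟨a, ha⟩ := hσ
  obtain ⟨b, hb⟩ := y.2
  exact ⟨b * a, by rw [ρ_mul_apply, ha, ← hom_ρ, hb]⟩

/-- **Restriction of orbit-stabilising automorphisms to the orbit**, as a group homomorphism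
`stabOrbit X x₀ → Aut (orbitObj X x₀)`. [cite: MochizukiSemiAnbd2006, Thm A.4 proof p.84] -/
def restrictOrbit : stabOrbit X x₀ →* Aut (orbitObj X x₀) where
  toFun σ := BTemp.isoOfEquiv
    { toFun := fun y => ⟨σ.1.hom.hom.hom y.1, exists_ρ_eq_aut_apply_of_mem_stabOrbit X x₀ σ.2 y⟩
      invFun := fun y => ⟨σ.1.inv.hom.hom y.1,
        exists_ρ_eq_aut_apply_of_mem_stabOrbit X x₀ ((stabOrbit X x₀).inv_mem σ.2) y⟩
      left_inv := fun y => Subtype.ext (by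
        change ((σ.1.hom ≫ σ.1.inv).hom.hom y.1 : X.obj.V) = y.1
        rw [σ.1.hom_inv_id]; rfl)
      right_inv := fun y => Subtype.ext (by
        change ((σ.1.inv ≫ σ.1.hom).hom.hom y.1 : X.obj.V) = y.1
        rw [σ.1.inv_hom_id]; rfl) }
    fun a y => Subtype.ext (hom_ρ σ.1.hom a y.1)
  map_one' := Iso.ext (hom_ext_apply fun _ => rfl)
  map_mul' σ τ := Iso.ext (hom_ext_apply fun _ => rfl)

/-- Restriction on points. [cite: MochizukiSemiAnbd2006, Thm A.4 proof p.84] -/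
@[simp] theorem restrictOrbit_apply_val (σ : stabOrbit X x₀) (y : (orbitObj X x₀).obj.V) :
    ((restrictOrbit X x₀ σ).hom.hom.hom y).1 = σ.1.hom.hom.hom y.1 := rfl

/-- Restriction is compatible with the inclusion of the orbit. [cite: MochizukiSemiAnbd2006, Thm A.4 proof p.84] -/
theorem restrictOrbit_incl (σ : stabOrbit X x₀) :
    (restrictOrbit X x₀ σ).hom ≫ orbitIncl X x₀ = orbitIncl X x₀ ≫ σ.1.hom :=
  hom_ext_apply fun _ => rfl

end Orbit

end BTemp

end Literature.AnabelianGeometry.SemiGraphs
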